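import Mathlib.MeasureTheory.Constructions.Cylinders
import Mathlib.MeasureTheory.Measure.Typeclasses.Finite
import Literature.MeasureTheory.OptimalTransport.KantorovichDuality
import HarnessLib

/-!
# Couplings control the marginals on local sets; vanishing disagreement forces equality
# (Conache–Kondratiev–Kozitsky–Pasurek 2015, Lemma 3.1, and the end of the proof of Theorem 2.6)

[topic Probability/TransportMaps]

[ConacheEtAl2015] D. Conache, Yu. Kondratiev, Yu. Kozitsky, T. Pasurek, arXiv:1501.00673, §3.1
(verbatim up to notation; `υ(ξ, η) = 1 − δ_{ξη}`, `𝒞(μ₁, μ₂)` = couplings of `μ₁, μ₂ ∈ 𝒫(Ξ^𝖫)`):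
**Lemma 3.1.** «Given a one-site specification `π` and `μ₁, μ₂ ∈ ℳ(π)`, suppose there exists
`ν_* ∈ 𝒞(μ₁, μ₂)` such that (15) `∫_{X²} υ(x_ℓ, y_ℓ) ν_*(dx, dy) = 0`, holding for all `ℓ ∈ 𝖫`. Then
`μ₁ = μ₂`.» Proof (printed): «Local sets `A ⊂ X` are measure defining … For `A ∈ ℬ(Ξ^D)` and the
indicator `𝕀_A`, we have `|𝕀_A(x) − 𝕀_A(y)| ≤ Σ_{ℓ∈D} υ(x_ℓ, y_ℓ)`, and then
`|μ₁(A) − μ₂(A)| ≤ Σ_{ℓ∈D} ∫_{X²} υ(x_ℓ, y_ℓ) ν_*(dx, dy) = 0`.» (The specification plays no role in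
the statement or the proof; it is dropped here.) End of the proof of Theorem 2.6 (§3.3): (18)
`γ(ν̂ₙ) = sup_ℓ ν̂ₙ(I_ℓ) → 0` along couplings `ν̂ₙ ∈ 𝒞(μ₁, μ₂)`, whence — in print via an
`𝔏`-limit point `ν_*` (Lemmas 3.3, 3.5) and Lemma 3.1 — `μ₁ = μ₂`.

THIS FILE (Mathlib generality: arbitrary index type `ι`, site spaces `α i` merely measurable, local
sets = `MeasureTheory.measurableCylinders`, disagreement at `ℓ` = the outer measure of
`{p | p.1 ℓ ≠ p.2 ℓ}` so that no measurability of the diagonal is needed):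
* `measure_fst_cylinder_le` — for ANY measure `ν` on `X²` and any cylinder `A` over `D`:
  `ν(A × X) ≤ ν(X × A) + Σ_{ℓ∈D} ν{x_ℓ ≠ y_ℓ}` (the displayed inequality of the printed proof);
* `IsCoupling.measure_cylinder_le_add` ∕ `…_le_add'` — for `ν ∈ 𝒞(μ₁, μ₂)` and a measurable cylinder:
  `μ₁(A) ≤ μ₂(A) + Σ_{ℓ∈D} ν(I_ℓ)` and symmetrically, i.e. `|μ₁(A) − μ₂(A)| ≤ Σ_{ℓ∈D} ν(I_ℓ)`;
* ★ `lemma_3_1` — Lemma 3.1 as printed (`ν_*(I_ℓ) = 0` for all `ℓ` ⟹ `μ₁ = μ₂`);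
* ★ `eq_of_forall_exists_coupling` — the form in which (18) is USED: if for every finite `D` and
  `ε > 0` some coupling has `ν(I_ℓ) ≤ ε` on `D`, then `μ₁ = μ₂` (a shorter road than print's
  `𝔏`-compactness, Lemmas 3.3 ∕ 3.5: local sets are measure defining, so no limit coupling is needed);
  `eq_of_tendsto_coupling` — the sequential version `ν̂ₙ(I_ℓ) → 0` for every `ℓ` ⟹ `μ₁ = μ₂`;
* `abs_integral_sub_integral_le_of_local` — the observable form used in (dc10): for a bounded
  measurable `f` depending only on the coordinates in `D`,
  `|μ₁(f) − μ₂(f)| ≤ 2‖f‖_∞ Σ_{ℓ∈D} ν(I_ℓ)` (print: `|Φ(x)| ≤ 2‖f‖_∞ ν^x_{N−1}(I_{ℓ₁})`).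

Nothing about specifications, lattice gauge theory or mass gaps. No named facts.

## References
* [ConacheEtAl2015] arXiv:1501.00673, §3.1 Lemma 3.1 with proof; §3.3 (18); §3.4 (dc10). Quoted
  from the held TeX, pp. 8–10.
* [DobrushinPechersky1983] R. L. Dobrushin, E. A. Pechersky, LNM 1021 (1983) 97–110, Lemma 1.
-/

noncomputable section

open MeasureTheory Set Finset

open scoped ENNReal NNReal Topology

namespace Literature.Probability.TransportMaps

namespace CouplingLocalSets

open Literature.MeasureTheory.OptimalTransport (IsCoupling)

variable {ι : Type*} {α : ι → Type*}

/-- The displayed inequality of the printed proof, for an arbitrary (outer) measure on `X²`: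
`ν(A × X) ≤ ν(X × A) + Σ_{ℓ∈D} ν{x_ℓ ≠ y_ℓ}` for a cylinder `A` over `D` — because
`|𝕀_A(x) − 𝕀_A(y)| ≤ Σ_{ℓ∈D} υ(x_ℓ, y_ℓ)`. [cite: ConacheEtAl2015, Lemma 3.1 (proof)] -/
theorem measure_fst_cylinder_le [∀ i, MeasurableSpace (α i)]
    (ν : Measure ((∀ i, α i) × (∀ i, α i))) (D : Finset ι) (B : Set (∀ i : D, α i)) :
    ν (Prod.fst ⁻¹' cylinder D B) ≤
      ν (Prod.snd ⁻¹' cylinder D B) + ∑ ℓ ∈ D, ν {p | p.1 ℓ ≠ p.2 ℓ} := by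
  have hsub : Prod.fst ⁻¹' cylinder D B ⊆
      Prod.snd ⁻¹' cylinder D B ∪ ⋃ ℓ ∈ D, {p : (∀ i, α i) × (∀ i, α i) | p.1 ℓ ≠ p.2 ℓ} := by
    intro p hp
    by_cases hD : ∀ ℓ ∈ D, p.1 ℓ = p.2 ℓ
    · left
      have hres : D.restrict p.1 = D.restrict p.2 := funext fun i => hD i i.2
      simp only [Set.mem_preimage, mem_cylinder] at hp ⊢
      rwa [← hres]
    · right
      push Not at hD
      obtain ⟨ℓ, hℓ, hne⟩ := hD
      exact Set.mem_biUnion hℓ hne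
  calc ν (Prod.fst ⁻¹' cylinder D B)
      ≤ ν (Prod.snd ⁻¹' cylinder D B ∪ ⋃ ℓ ∈ D, {p | p.1 ℓ ≠ p.2 ℓ}) := measure_mono hsub
    _ ≤ ν (Prod.snd ⁻¹' cylinder D B) + ν (⋃ ℓ ∈ D, {p | p.1 ℓ ≠ p.2 ℓ}) := measure_union_le _ _
    _ ≤ ν (Prod.snd ⁻¹' cylinder D B) + ∑ ℓ ∈ D, ν {p | p.1 ℓ ≠ p.2 ℓ} := by
        gcongr; exact measure_biUnion_finset_le D _

/-- The symmetric inequality `ν(X × A) ≤ ν(A × X) + Σ_{ℓ∈D} ν{x_ℓ ≠ y_ℓ}`.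
[cite: ConacheEtAl2015, Lemma 3.1 (proof)] -/
theorem measure_snd_cylinder_le [∀ i, MeasurableSpace (α i)]
    (ν : Measure ((∀ i, α i) × (∀ i, α i))) (D : Finset ι) (B : Set (∀ i : D, α i)) :
    ν (Prod.snd ⁻¹' cylinder D B) ≤
      ν (Prod.fst ⁻¹' cylinder D B) + ∑ ℓ ∈ D, ν {p | p.1 ℓ ≠ p.2 ℓ} := by
  have h := measure_fst_cylinder_le (ν.map Prod.swap) D B
  have hsw : ∀ s : Set ((∀ i, α i) × (∀ i, α i)), ν.map Prod.swap s = ν (Prod.swap ⁻¹' s) :=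
    fun s => MeasurableEquiv.prodComm.map_apply s
  simp only [hsw] at h
  have h1 : Prod.swap ⁻¹' (Prod.fst ⁻¹' cylinder D B) =
      (Prod.snd ⁻¹' cylinder D B : Set ((∀ i, α i) × (∀ i, α i))) := by ext; simp
  have h2 : Prod.swap ⁻¹' (Prod.snd ⁻¹' cylinder D B) =
      (Prod.fst ⁻¹' cylinder D B : Set ((∀ i, α i) × (∀ i, α i))) := by ext; simp
  have h3 : ∀ ℓ, Prod.swap ⁻¹' {p : (∀ i, α i) × (∀ i, α i) | p.1 ℓ ≠ p.2 ℓ} =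
      {p : (∀ i, α i) × (∀ i, α i) | p.1 ℓ ≠ p.2 ℓ} := by
    intro ℓ; ext p; simp [ne_comm]
  simpa [h1, h2, h3] using h

variable [∀ i, MeasurableSpace (α i)] {μ₁ μ₂ : Measure (∀ i, α i)}
  {ν : Measure ((∀ i, α i) × (∀ i, α i))}

/-- For a coupling `ν ∈ 𝒞(μ₁, μ₂)` and a local set `A ∈ ℬ(Ξ^D)`:
`μ₁(A) ≤ μ₂(A) + Σ_{ℓ∈D} ν(I_ℓ)`. [cite: ConacheEtAl2015, Lemma 3.1 (proof)] -/
theorem measure_cylinder_le_add (h : IsCoupling μ₁ μ₂ ν) (D : Finset ι) {B : Set (∀ i : D, α i)}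
    (hB : MeasurableSet B) :
    μ₁ (cylinder D B) ≤ μ₂ (cylinder D B) + ∑ ℓ ∈ D, ν {p | p.1 ℓ ≠ p.2 ℓ} := by
  rw [← h.map_fst, ← h.map_snd, Measure.map_apply measurable_fst hB.cylinder,
    Measure.map_apply measurable_snd hB.cylinder]
  exact measure_fst_cylinder_le ν D B

/-- Symmetrically `μ₂(A) ≤ μ₁(A) + Σ_{ℓ∈D} ν(I_ℓ)`; together:
`|μ₁(A) − μ₂(A)| ≤ Σ_{ℓ∈D} ∫ υ(x_ℓ, y_ℓ) ν(dx, dy)`. [cite: ConacheEtAl2015, Lemma 3.1 (proof)] -/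
theorem measure_cylinder_le_add' (h : IsCoupling μ₁ μ₂ ν) (D : Finset ι) {B : Set (∀ i : D, α i)}
    (hB : MeasurableSet B) :
    μ₂ (cylinder D B) ≤ μ₁ (cylinder D B) + ∑ ℓ ∈ D, ν {p | p.1 ℓ ≠ p.2 ℓ} := by
  rw [← h.map_fst, ← h.map_snd, Measure.map_apply measurable_fst hB.cylinder,
    Measure.map_apply measurable_snd hB.cylinder]
  exact measure_snd_cylinder_le ν D B

/-- The printed real form `|μ₁(A) − μ₂(A)| ≤ Σ_{ℓ∈D} ν(I_ℓ)` for finite measures.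
[cite: ConacheEtAl2015, Lemma 3.1 (proof)] -/
theorem abs_measureReal_cylinder_sub_le [IsFiniteMeasure μ₁] [IsFiniteMeasure μ₂]
    [IsFiniteMeasure ν] (h : IsCoupling μ₁ μ₂ ν) (D : Finset ι) {B : Set (∀ i : D, α i)}
    (hB : MeasurableSet B) :
    |μ₁.real (cylinder D B) - μ₂.real (cylinder D B)| ≤ ∑ ℓ ∈ D, ν.real {p | p.1 ℓ ≠ p.2 ℓ} := by
  have h1 := measure_cylinder_le_add h D hB
  have h2 := measure_cylinder_le_add' h D hB
  have hs : (∑ ℓ ∈ D, ν {p : (∀ i, α i) × (∀ i, α i) | p.1 ℓ ≠ p.2 ℓ}).toReal =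
      ∑ ℓ ∈ D, ν.real {p | p.1 ℓ ≠ p.2 ℓ} :=
    ENNReal.toReal_sum fun ℓ _ => measure_ne_top ν _
  have r1 : μ₁.real (cylinder D B) ≤ μ₂.real (cylinder D B) + ∑ ℓ ∈ D, ν.real {p | p.1 ℓ ≠ p.2 ℓ} := by
    rw [← hs, Measure.real, Measure.real, ← ENNReal.toReal_add (measure_ne_top _ _)
      (ENNReal.sum_ne_top.2 fun ℓ _ => measure_ne_top ν _)]
    exact ENNReal.toReal_mono (ENNReal.add_ne_top.2 ⟨measure_ne_top _ _,
      ENNReal.sum_ne_top.2 fun ℓ _ => measure_ne_top ν _⟩) h1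
  have r2 : μ₂.real (cylinder D B) ≤ μ₁.real (cylinder D B) + ∑ ℓ ∈ D, ν.real {p | p.1 ℓ ≠ p.2 ℓ} := by
    rw [← hs, Measure.real, Measure.real, ← ENNReal.toReal_add (measure_ne_top _ _)
      (ENNReal.sum_ne_top.2 fun ℓ _ => measure_ne_top ν _)]
    exact ENNReal.toReal_mono (ENNReal.add_ne_top.2 ⟨measure_ne_top _ _,
      ENNReal.sum_ne_top.2 fun ℓ _ => measure_ne_top ν _⟩) h2
  rw [abs_sub_le_iff]
  constructor <;> linarith

/-- Local sets are measure defining: two finite measures on `Ξ^𝖫` that agree on every measurable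
cylinder and have the same mass are equal. [cite: ConacheEtAl2015, Lemma 3.1 (proof, first sentence)] -/
theorem ext_of_cylinder [IsFiniteMeasure μ₁]
    (hcyl : ∀ (D : Finset ι) (B : Set (∀ i : D, α i)), MeasurableSet B →
      μ₁ (cylinder D B) = μ₂ (cylinder D B)) (huniv : μ₁ univ = μ₂ univ) : μ₁ = μ₂ := by
  refine ext_of_generate_finite (measurableCylinders α) generateFrom_measurableCylinders.symm
    isPiSystem_measurableCylinders (fun s hs => ?_) huniv
  obtain ⟨D, B, hB, rfl⟩ := (mem_measurableCylinders s).1 hs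
  exact hcyl D B hB

/-- **Lemma 3.1 (Conache–Kondratiev–Kozitsky–Pasurek; Dobrushin–Pechersky Lemma 1).** If some
coupling `ν_* ∈ 𝒞(μ₁, μ₂)` has `ν_*(I_ℓ) = ν_*{x_ℓ ≠ y_ℓ} = 0` for every site `ℓ`, then `μ₁ = μ₂`.
[cite: ConacheEtAl2015, Lemma 3.1] -/
theorem lemma_3_1 [IsFiniteMeasure μ₁] (h : IsCoupling μ₁ μ₂ ν)
    (h0 : ∀ ℓ, ν {p | p.1 ℓ ≠ p.2 ℓ} = 0) : μ₁ = μ₂ := by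
  refine ext_of_cylinder (fun D B hB => le_antisymm ?_ ?_) h.measure_univ_eq
  · simpa [h0] using measure_cylinder_le_add h D hB
  · simpa [h0] using measure_cylinder_le_add' h D hB

/-- **(18) ⟹ `μ₁ = μ₂`, directly.** If for every finite `D ⊂ 𝖫` and every `ε > 0` there is a
coupling `ν ∈ 𝒞(μ₁, μ₂)` with `ν(I_ℓ) ≤ ε` for all `ℓ ∈ D`, then `μ₁ = μ₂` — by Lemma 3.1's
inequality `|μ₁(A) − μ₂(A)| ≤ Σ_{ℓ∈D} ν(I_ℓ) ≤ |D| ε` on local sets, which are measure defining (print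
reaches the same end through an `𝔏`-limit point `ν_*` and Lemma 3.1).
[cite: ConacheEtAl2015, Theorem 2.6 (proof, §3.3: (18) and Lemma 3.1)] -/
theorem eq_of_forall_exists_coupling [IsFiniteMeasure μ₁]
    (hε : ∀ (D : Finset ι) (ε : ℝ≥0), 0 < ε → ∃ ν : Measure ((∀ i, α i) × (∀ i, α i)),
      IsCoupling μ₁ μ₂ ν ∧ ∀ ℓ ∈ D, ν {p | p.1 ℓ ≠ p.2 ℓ} ≤ ε) : μ₁ = μ₂ := by
  obtain ⟨ν₀, hν₀, -⟩ := hε ∅ 1 one_pos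
  -- the sum of the disagreements over `D` can be made `≤ ε`
  have hsum : ∀ (D : Finset ι) (ε : ℝ≥0), 0 < ε → ∃ ν : Measure ((∀ i, α i) × (∀ i, α i)),
      IsCoupling μ₁ μ₂ ν ∧ ∑ ℓ ∈ D, ν {p | p.1 ℓ ≠ p.2 ℓ} ≤ ε := by
    intro D ε hε0
    obtain ⟨ν, hν, hle⟩ := hε D (ε / (D.card + 1)) (by positivity)
    refine ⟨ν, hν, ?_⟩
    calc ∑ ℓ ∈ D, ν {p | p.1 ℓ ≠ p.2 ℓ} ≤ ∑ _ℓ ∈ D, ((ε / (D.card + 1) : ℝ≥0) : ℝ≥0∞) :=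
          Finset.sum_le_sum hle
      _ = ((D.card * (ε / (D.card + 1)) : ℝ≥0) : ℝ≥0∞) := by
          rw [sum_const, nsmul_eq_mul]; push_cast; ring
      _ ≤ ε := by
          have : (D.card : ℝ≥0) * (ε / (D.card + 1)) ≤ ε := by
            rw [mul_div_assoc', div_le_iff₀ (by positivity), mul_comm ε]
            gcongr
            exact le_self_add
          exact_mod_cast this
  refine ext_of_cylinder (fun D B hB => le_antisymm ?_ ?_) hν₀.measure_univ_eq
  · refine ENNReal.le_of_forall_pos_le_add fun ε hε0 _ => ?_
    obtain ⟨ν, hν, hle⟩ := hsum D ε hε0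
    exact (measure_cylinder_le_add hν D hB).trans (by gcongr)
  · refine ENNReal.le_of_forall_pos_le_add fun ε hε0 _ => ?_
    obtain ⟨ν, hν, hle⟩ := hsum D ε hε0
    exact (measure_cylinder_le_add' hν D hB).trans (by gcongr)

/-- **The sequential form of (18) ⟹ uniqueness.** Couplings `ν̂ₙ ∈ 𝒞(μ₁, μ₂)` with
`ν̂ₙ(I_ℓ) → 0` for every site `ℓ` (in print: `γ(ν̂ₙ) = sup_ℓ ν̂ₙ(I_ℓ) → 0`) force `μ₁ = μ₂`.
[cite: ConacheEtAl2015, Theorem 2.6 (proof, §3.3: (18) and Lemma 3.1)] -/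
theorem eq_of_tendsto_coupling [IsFiniteMeasure μ₁] (νs : ℕ → Measure ((∀ i, α i) × (∀ i, α i)))
    (hc : ∀ n, IsCoupling μ₁ μ₂ (νs n))
    (h0 : ∀ ℓ, Filter.Tendsto (fun n => νs n {p | p.1 ℓ ≠ p.2 ℓ}) Filter.atTop (𝓝 0)) :
    μ₁ = μ₂ := by
  refine eq_of_forall_exists_coupling fun D ε hε => ?_
  -- eventually every disagreement on the finite set `D` is `≤ ε`
  have hev : ∀ᶠ n in Filter.atTop, ∀ ℓ ∈ D, νs n {p | p.1 ℓ ≠ p.2 ℓ} ≤ ε := by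
    rw [Filter.eventually_all_finset]
    intro ℓ _
    exact (h0 ℓ).eventually (ge_mem_nhds (by exact_mod_cast hε))
  obtain ⟨n, hn⟩ := hev.exists
  exact ⟨νs n, hc n, hn⟩

/-- **The observable form (as in (dc10)).** For a coupling `ν ∈ 𝒞(μ₁, μ₂)` and a bounded measurable
`f` that depends only on the coordinates in the finite set `D` (`|f| ≤ M`):
`|∫ f dμ₁ − ∫ f dμ₂| ≤ 2M · Σ_{ℓ∈D} ν(I_ℓ)` — print, for `f` measurable in the spin at `ℓ₁`:
«`|Φ(x)| ≤ 2‖f‖_∞ ν^x_{N−1}(I_{ℓ₁})`». No measurability of the diagonal is used (the disagreement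
sets enter through the outer measure). [cite: ConacheEtAl2015, §3.4 (dc10)] -/
theorem abs_integral_sub_integral_le_of_local [IsFiniteMeasure μ₁] (h : IsCoupling μ₁ μ₂ ν)
    (D : Finset ι) {f : (∀ i, α i) → ℝ} (hf : Measurable f)
    (hloc : ∀ x y, (∀ ℓ ∈ D, x ℓ = y ℓ) → f x = f y) {M : ℝ} (hM0 : 0 ≤ M)
    (hM : ∀ x, |f x| ≤ M) :
    |∫ x, f x ∂μ₁ - ∫ y, f y ∂μ₂| ≤ 2 * M * (∑ ℓ ∈ D, ν {p | p.1 ℓ ≠ p.2 ℓ}).toReal := by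
  haveI : IsFiniteMeasure ν := h.isFiniteMeasure
  haveI : IsFiniteMeasure μ₂ := by
    constructor; rw [← h.measure_univ_eq]; exact measure_lt_top μ₁ _
  -- both integrals are integrals against the coupling
  have I1 : ∫ x, f x ∂μ₁ = ∫ p, f p.1 ∂ν := (h.integral_comp_fst hf.aestronglyMeasurable).symm
  have I2 : ∫ y, f y ∂μ₂ = ∫ p, f p.2 ∂ν := (h.integral_comp_snd hf.aestronglyMeasurable).symm
  have hint1 : Integrable (fun p : (∀ i, α i) × (∀ i, α i) => f p.1) ν :=
    (integrable_const M).mono' (hf.comp measurable_fst).aestronglyMeasurable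
      (ae_of_all _ fun p => by simpa [Real.norm_eq_abs] using hM p.1)
  have hint2 : Integrable (fun p : (∀ i, α i) × (∀ i, α i) => f p.2) ν :=
    (integrable_const M).mono' (hf.comp measurable_snd).aestronglyMeasurable
      (ae_of_all _ fun p => by simpa [Real.norm_eq_abs] using hM p.2)
  rw [I1, I2, ← integral_sub hint1 hint2]
  -- pointwise: `|f x − f y| ≤ 2M · 𝟙{∃ ℓ ∈ D, x_ℓ ≠ y_ℓ}`
  set U : Set ((∀ i, α i) × (∀ i, α i)) := ⋃ ℓ ∈ D, {p | p.1 ℓ ≠ p.2 ℓ} with hU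
  have hpt : ∀ p : (∀ i, α i) × (∀ i, α i),
      ENNReal.ofReal ‖f p.1 - f p.2‖ ≤ ENNReal.ofReal (2 * M) * U.indicator 1 p := by
    intro p
    by_cases hp : p ∈ U
    · rw [Set.indicator_of_mem hp, Pi.one_apply, mul_one]
      apply ENNReal.ofReal_le_ofReal
      rw [Real.norm_eq_abs]
      calc |f p.1 - f p.2| ≤ |f p.1| + |f p.2| := abs_sub _ _
        _ ≤ M + M := add_le_add (hM _) (hM _)
        _ = 2 * M := by ring
    · have hD : ∀ ℓ ∈ D, p.1 ℓ = p.2 ℓ := by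
        intro ℓ hℓ
        by_contra hne
        exact hp (Set.mem_biUnion hℓ hne)
      simp [hloc p.1 p.2 hD, Set.indicator_of_notMem hp]
  have hlin : ∫⁻ p, ENNReal.ofReal ‖f p.1 - f p.2‖ ∂ν ≤
      ENNReal.ofReal (2 * M) * ∑ ℓ ∈ D, ν {p | p.1 ℓ ≠ p.2 ℓ} :=
    calc ∫⁻ p, ENNReal.ofReal ‖f p.1 - f p.2‖ ∂ν
        ≤ ∫⁻ p, ENNReal.ofReal (2 * M) * U.indicator 1 p ∂ν := lintegral_mono hpt
      _ = ENNReal.ofReal (2 * M) * ∫⁻ p, U.indicator 1 p ∂ν :=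
          lintegral_const_mul' _ _ ENNReal.ofReal_ne_top
      _ ≤ ENNReal.ofReal (2 * M) * ν U := by gcongr; exact lintegral_indicator_one_le U
      _ ≤ ENNReal.ofReal (2 * M) * ∑ ℓ ∈ D, ν {p | p.1 ℓ ≠ p.2 ℓ} := by
          gcongr; exact measure_biUnion_finset_le D _
  have hfin : ENNReal.ofReal (2 * M) * ∑ ℓ ∈ D, ν {p | p.1 ℓ ≠ p.2 ℓ} ≠ ⊤ :=
    ENNReal.mul_ne_top ENNReal.ofReal_ne_top (ENNReal.sum_ne_top.2 fun ℓ _ => measure_ne_top ν _)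
  calc |∫ p, f p.1 - f p.2 ∂ν| = ‖∫ p, f p.1 - f p.2 ∂ν‖ := (Real.norm_eq_abs _).symm
    _ ≤ (∫⁻ p, ENNReal.ofReal ‖f p.1 - f p.2‖ ∂ν).toReal := norm_integral_le_lintegral_norm _
    _ ≤ (ENNReal.ofReal (2 * M) * ∑ ℓ ∈ D, ν {p | p.1 ℓ ≠ p.2 ℓ}).toReal :=
        ENNReal.toReal_mono hfin hlin
    _ = 2 * M * (∑ ℓ ∈ D, ν {p | p.1 ℓ ≠ p.2 ℓ}).toReal := by
        rw [ENNReal.toReal_mul, ENNReal.toReal_ofReal (by positivity)]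

end CouplingLocalSets

end Literature.Probability.TransportMaps
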